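import Mathlib

/-!
# The three enumerated families: palindromic (`rec`), antipalindromic (`anti`), odd degree

Cell `pub-namedobj`, seat `pub-namedobj-mahler-g2`, target (L). Framing: lottery ticket; floor = certified
bounds/negative ranges.

Root-free structure lemmas over `ℤ[x]` for the families enumerated by the census engines
(`HOME/code/censusL/polyz.py: build_full`):

* `reverse_eq_self_of_palindromic` / `palindromic_of_reverse_eq_self`: `a_j = a_{N-j}` iff `reverse P = P`
  (for `natDegree P = N`); `reverse_eq_neg_of_antipalindromic` for `a_j = -a_{N-j}`;
* `eval_neg_one_eq_zero_of_palindromic_odd`: an odd-degree palindromic `P` has `P(-1) = 0`;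
  `eval_one_eq_zero_of_antipalindromic`, `eval_neg_one_eq_zero_of_antipalindromic_even`;
* `odd_palindromic_decomposition`: monic palindromic `P` of degree `2d+1` is `(x+1)·R` with `R` monic palindromic
  of degree `2d`;
* `antipalindromic_decomposition`: monic antipalindromic `P` of degree `2d ≥ 2` is `(x²-1)·R` with `R` monic
  palindromic of degree `2d-2`.

These reduce the `anti` and odd-`n` families to the `rec` family treated in `ReciprocalFactorisation.lean`.
-/

namespace Summit.Ventures.DiscreteObjects.Mahler

open Polynomial

/-- Palindromic coefficients ⇒ `reverse P = P`. -/
theorem reverse_eq_self_of_palindromic {R : Type*} [CommRing R] (P : R[X]) (N : ℕ) (hdeg : P.natDegree = N)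
    (hpal : ∀ j ≤ N, P.coeff j = P.coeff (N - j)) : P.reverse = P := by
  ext j
  by_cases hj : j ≤ N
  · rw [coeff_reverse, hdeg, revAt_le hj, ← hpal j hj]
  · rw [not_le] at hj
    rw [coeff_eq_zero_of_natDegree_lt (lt_of_le_of_lt (reverse_natDegree_le P) (by rw [hdeg]; exact hj)),
      coeff_eq_zero_of_natDegree_lt (by rw [hdeg]; exact hj)]

/-- Antipalindromic coefficients ⇒ `reverse P = -P`. -/
theorem reverse_eq_neg_of_antipalindromic {R : Type*} [CommRing R] (P : R[X]) (N : ℕ) (hdeg : P.natDegree = N)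
    (hapal : ∀ j ≤ N, P.coeff j = -P.coeff (N - j)) : P.reverse = -P := by
  ext j
  rw [coeff_neg]
  by_cases hj : j ≤ N
  · rw [coeff_reverse, hdeg, revAt_le hj, hapal j hj, neg_neg]
  · rw [not_le] at hj
    rw [coeff_eq_zero_of_natDegree_lt (lt_of_le_of_lt (reverse_natDegree_le P) (by rw [hdeg]; exact hj)),
      coeff_eq_zero_of_natDegree_lt (by rw [hdeg]; exact hj), neg_zero]

/-- `reverse R = R` ⇒ palindromic coefficients. -/
theorem palindromic_of_reverse_eq_self {R : Type*} [CommRing R] (P : R[X]) (N : ℕ) (hdeg : P.natDegree = N)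
    (hrev : P.reverse = P) : ∀ j ≤ N, P.coeff j = P.coeff (N - j) := by
  intro j hj
  conv_lhs => rw [← hrev]
  rw [coeff_reverse, hdeg, revAt_le hj]

/-- Evaluation identity for self-reverse / anti-self-reverse polynomials at `±1`. -/
theorem eval_eq_eval_reverse_mul {R : Type*} [CommRing R] (P : R[X]) (x : R) (hx : x * x = 1) :
    P.eval x = P.reverse.eval x * x ^ P.natDegree := by
  haveI : Invertible x := ⟨x, hx, hx⟩
  have h := eval₂_reverse_mul_pow (RingHom.id R) x P
  rw [eval₂_id, eval₂_id] at h
  have hinv : (⅟x : R) = x := by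
    rw [← mul_one (⅟x), ← hx, ← mul_assoc, invOf_mul_self, one_mul]
  rw [hinv] at h
  exact h.symm

/-- An odd-degree palindromic integer polynomial vanishes at `-1`. -/
theorem eval_neg_one_eq_zero_of_palindromic_odd (P : ℤ[X]) (d : ℕ) (hdeg : P.natDegree = 2 * d + 1)
    (hpal : ∀ j ≤ 2 * d + 1, P.coeff j = P.coeff (2 * d + 1 - j)) : P.eval (-1) = 0 := by
  have h := eval_eq_eval_reverse_mul P (-1) (by norm_num)
  rw [reverse_eq_self_of_palindromic P _ hdeg hpal, hdeg, pow_succ, pow_mul] at h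
  norm_num at h
  linarith

/-- An antipalindromic integer polynomial vanishes at `1`. -/
theorem eval_one_eq_zero_of_antipalindromic (P : ℤ[X]) (N : ℕ) (hdeg : P.natDegree = N)
    (hapal : ∀ j ≤ N, P.coeff j = -P.coeff (N - j)) : P.eval 1 = 0 := by
  have h := eval_eq_eval_reverse_mul P 1 (by norm_num)
  rw [reverse_eq_neg_of_antipalindromic P N hdeg hapal, eval_neg, one_pow, mul_one] at h
  linarith

/-- An even-degree antipalindromic integer polynomial vanishes at `-1`. -/
theorem eval_neg_one_eq_zero_of_antipalindromic_even (P : ℤ[X]) (d : ℕ) (hdeg : P.natDegree = 2 * d)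
    (hapal : ∀ j ≤ 2 * d, P.coeff j = -P.coeff (2 * d - j)) : P.eval (-1) = 0 := by
  have h := eval_eq_eval_reverse_mul P (-1) (by norm_num)
  rw [reverse_eq_neg_of_antipalindromic P _ hdeg hapal, eval_neg, hdeg, pow_mul] at h
  norm_num at h
  linarith

/-- `reverse (x + 1) = x + 1`. -/
theorem reverse_X_add_one {R : Type*} [CommRing R] [Nontrivial R] : (X + 1 : R[X]).reverse = X + 1 := by
  apply reverse_eq_self_of_palindromic (X + 1 : R[X]) 1 (by compute_degree!)
  intro j hj
  interval_cases j <;> simp [coeff_X, coeff_one]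

/-- `reverse (x² - 1) = -(x² - 1)`. -/
theorem reverse_X_sq_sub_one {R : Type*} [CommRing R] [Nontrivial R] :
    (X ^ 2 - 1 : R[X]).reverse = -(X ^ 2 - 1) := by
  apply reverse_eq_neg_of_antipalindromic (X ^ 2 - 1 : R[X]) 2 (by compute_degree!)
  intro j hj
  interval_cases j <;> simp [coeff_X_pow, coeff_one]

/-- **Odd-degree `rec` family.** A monic palindromic `P ∈ ℤ[x]` of degree `2d+1` is `(x+1)·R` with `R` monic
palindromic of degree `2d`. -/
theorem odd_palindromic_decomposition (P : ℤ[X]) (d : ℕ) (hmonic : P.Monic) (hdeg : P.natDegree = 2 * d + 1)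
    (hpal : ∀ j ≤ 2 * d + 1, P.coeff j = P.coeff (2 * d + 1 - j)) :
    ∃ R : ℤ[X], P = (X + 1) * R ∧ R.Monic ∧ R.natDegree = 2 * d ∧
      ∀ j ≤ 2 * d, R.coeff j = R.coeff (2 * d - j) := by
  have hroot : P.IsRoot (-1) := eval_neg_one_eq_zero_of_palindromic_odd P d hdeg hpal
  set R := P /ₘ (X + 1) with hR
  have hXR : (X + 1 : ℤ[X]) = X - C (-1) := by simp
  have hPR : P = (X + 1) * R := by
    rw [hR, hXR]; exact ((mul_divByMonic_eq_iff_isRoot).mpr hroot).symm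
  have hX1 : (X + 1 : ℤ[X]).Monic := by rw [hXR]; exact monic_X_sub_C _
  have hRmonic : R.Monic := Monic.of_mul_monic_left hX1 (hPR ▸ hmonic)
  have hRdeg : R.natDegree = 2 * d := by
    have h := congrArg natDegree hPR
    rw [hX1.natDegree_mul hRmonic, hdeg, show (X + 1 : ℤ[X]).natDegree = 1 by compute_degree!] at h
    omega
  have hRrev : R.reverse = R := by
    have h1 : P.reverse = P := reverse_eq_self_of_palindromic P _ hdeg hpal
    rw [hPR, reverse_mul_of_domain, reverse_X_add_one] at h1
    exact mul_left_cancel₀ hX1.ne_zero h1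
  exact ⟨R, hPR, hRmonic, hRdeg, palindromic_of_reverse_eq_self R _ hRdeg hRrev⟩

/-- **`anti` family.** A monic antipalindromic `P ∈ ℤ[x]` of degree `2d ≥ 2` is `(x²-1)·R` with `R` monic
palindromic of degree `2d-2`. -/
theorem antipalindromic_decomposition (P : ℤ[X]) (d : ℕ) (hd : 1 ≤ d) (hmonic : P.Monic)
    (hdeg : P.natDegree = 2 * d) (hapal : ∀ j ≤ 2 * d, P.coeff j = -P.coeff (2 * d - j)) :
    ∃ R : ℤ[X], P = (X ^ 2 - 1) * R ∧ R.Monic ∧ R.natDegree = 2 * d - 2 ∧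
      ∀ j ≤ 2 * d - 2, R.coeff j = R.coeff (2 * d - 2 - j) := by
  have hroot1 : P.IsRoot 1 := eval_one_eq_zero_of_antipalindromic P _ hdeg hapal
  have hrootm : P.IsRoot (-1) := eval_neg_one_eq_zero_of_antipalindromic_even P d hdeg hapal
  -- divide by (x - 1)
  set P₁ := P /ₘ (X - C 1) with hP₁
  have hPP₁ : P = (X - C 1) * P₁ := ((mul_divByMonic_eq_iff_isRoot).mpr hroot1).symm
  have hP₁root : P₁.IsRoot (-1) := by
    have h := hrootm
    rw [IsRoot, hPP₁, eval_mul] at h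
    have h2 : eval (-1 : ℤ) (X - C 1 : ℤ[X]) = -2 := by norm_num
    rw [h2] at h
    rw [IsRoot]
    linarith [h]  -- -2 * e = 0
  set R := P₁ /ₘ (X - C (-1)) with hR
  have hP₁R : P₁ = (X - C (-1)) * R := ((mul_divByMonic_eq_iff_isRoot).mpr hP₁root).symm
  have hPR : P = (X ^ 2 - 1) * R := by
    rw [hPP₁, hP₁R, ← mul_assoc]
    congr 1
    simp; ring
  have hQ : (X ^ 2 - 1 : ℤ[X]).Monic := by monicity!
  have hRmonic : R.Monic := Monic.of_mul_monic_left hQ (hPR ▸ hmonic)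
  have hRdeg : R.natDegree = 2 * d - 2 := by
    have h := congrArg natDegree hPR
    rw [hQ.natDegree_mul hRmonic, hdeg, show (X ^ 2 - 1 : ℤ[X]).natDegree = 2 by compute_degree!] at h
    omega
  have hRrev : R.reverse = R := by
    have h1 : P.reverse = -P := reverse_eq_neg_of_antipalindromic P _ hdeg hapal
    rw [hPR, reverse_mul_of_domain, reverse_X_sq_sub_one, neg_mul, neg_inj] at h1
    exact mul_left_cancel₀ hQ.ne_zero h1
  exact ⟨R, hPR, hRmonic, hRdeg, palindromic_of_reverse_eq_self R _ hRdeg hRrev⟩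

end Summit.Ventures.DiscreteObjects.Mahler
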